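import Summits.MatrixMultiplication.OmegaCensus.DicyclicLawZ4Z4Reduction
import Summits.MatrixMultiplication.OmegaCensus.DihedralLawModOneNonCube
import HarnessLib

/-!
# The dicyclic law at `|A| = 32` reduced to a stability statement, for quotients `A/⟨c₀⟩ ↠ ℤ₄ × ℤ₄`

ω-census `pub-omega`, family (b3), seat pub-omega-group gen 15.  Framing: lottery ticket; floor = certified bounds/negative
ranges.  VALUE: kernel theorems about the group-theoretic method (TPP capacity of dihedral-like groups); NOT progress on ω.

This is gen 14's `DicyclicLawZ4Z4Reduction.lean` (`|A| = 128`) at `|A| = 32`, i.e. for the order-`64` dicyclic-type groups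
`G(A, c₀)` whose quotient `A/⟨c₀⟩` is `ℤ₄ × ℤ₄` (`G(ℤ₄×ℤ₈,(0,4))` = NR117 and `G(ℤ₂×ℤ₄²,(1,0,0))` = NR118 of the census,
engine rows ×2 so far).  A TPP triple of `G(A, c₀)` with a member stable under a central involution `ρ(a)` descends to the
quotient by `⟨a⟩`:
* `a = c₀`: the descended triple attains the mod-one law of `Dih(A/⟨c₀⟩)`, `|A/⟨c₀⟩| = 16 = 3·5 + 1`, which by
  `two_cosets_of_mod_one_law_prime` makes `A/⟨c₀⟩` two cosets of a cyclic subgroup — impossible for a group mapping onto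
  `ℤ₄²` (`not_two_cosets_of_onto_z4z4`); this is `no_mod_one_law_card_16_of_onto_z4z4`, where `|A| = 32` is used;
* `a ≠ c₀`: as at `|A| = 128` (`quot_cyclic_of_mod_one_law_of_c0_ne_zero` + `not_four_cosets_of_onto_z4z4`).
Results: `no_dicyclic_law_of_stable_third_32`, `no_dicyclic_law_of_stable_member_32`, `no_dicyclic_law_of_two_domino_32`.
-/

namespace Summit.MatrixMultiplication.OmegaCensus

open Literature.Combinatorics.Additive Finset

/-! ## The Dih side at `|A| = 16` -/

section Dih16

variable {A : Type} [AddCommGroup A] [DecidableEq A] [Fintype A] {G : Type} [Group G] [DecidableEq G]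
  {ρ τ : A → G} {c₀ : A} {S T U : Finset G}

/-- **`|A| = 16`, `A ↠ ℤ₄ × ℤ₄` (i.e. `A ≅ ℤ₄²`): no dihedral-like group over `A` (any `c₀`) attains
`3|S||T||U| + 8 = 8|A|`** (`(|A|−1)/3 = 5` is prime, so a law triple makes `A` two cosets of a cyclic subgroup).
[folklore] -/
theorem no_mod_one_law_card_16_of_onto_z4z4
    (hρρ : ∀ a b, ρ a * ρ b = ρ (a + b)) (hρτ : ∀ a b, ρ a * τ b = τ (b - a))
    (hτρ : ∀ a b, τ a * ρ b = τ (a + b)) (hττ : ∀ a b, τ a * τ b = ρ (c₀ + b - a))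
    (hρ : Function.Injective ρ) (hτ : Function.Injective τ) (hne : ∀ a b, ρ a ≠ τ b)
    (hsurj : ∀ g, (∃ a, ρ a = g) ∨ (∃ a, τ a = g)) (hA : Fintype.card A = 16)
    (φ : A →+ ZMod 4 × ZMod 4) (hφ : Function.Surjective φ) (h : TripleProductProperty S T U) :
    3 * (S.card * T.card * U.card) + 8 ≠ 8 * Fintype.card A := by
  intro hV
  obtain ⟨g, a, b, hab⟩ := two_cosets_of_mod_one_law_prime (p := 5) (by norm_num) hρρ hρτ hτρ hττ hρ hτ hne hsurj
    (by rw [hA]) (by rw [hA]; norm_num) h hV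
  exact not_two_cosets_of_onto_z4z4 φ hφ g a b hab

end Dih16

/-! ## The reduction at `|A| = 32` -/

section Reduction

variable {A : Type} [AddCommGroup A] [DecidableEq A] [Fintype A] {G : Type} [Group G] [DecidableEq G]
  {ρ τ : A → G} {c₀ : A}

/-- **Stable third member ⇒ no dicyclic law (`|A| = 32`, `A/⟨c₀⟩ ↠ ℤ₄²`).**  Dicyclic type (`c₀ ≠ 0`), `|A| = 32`,
`Φ : A →+ ZMod 4 × ZMod 4` onto with `Φ c₀ = 0`; a TPP triple whose third member is stable under right multiplication by a
central involution `ρ(a)` (`2a = 0 ≠ a`).  Then `3|S||T||U| + 16 ≠ 8|A|`. [folklore] -/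
theorem no_dicyclic_law_of_stable_third_32
    (hρρ : ∀ a b, ρ a * ρ b = ρ (a + b)) (hρτ : ∀ a b, ρ a * τ b = τ (b - a))
    (hτρ : ∀ a b, τ a * ρ b = τ (a + b)) (hττ : ∀ a b, τ a * τ b = ρ (c₀ + b - a)) (hc₀ : c₀ ≠ 0)
    (hρ : Function.Injective ρ) (hτ : Function.Injective τ) (hne : ∀ a b, ρ a ≠ τ b)
    (hsurj : ∀ g, (∃ a, ρ a = g) ∨ (∃ a, τ a = g)) (hA : Fintype.card A = 32)
    (Φ : A →+ ZMod 4 × ZMod 4) (hΦ : Function.Surjective Φ) (hΦc : Φ c₀ = 0)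
    {S T U : Finset G} (h : TripleProductProperty S T U)
    {a : A} (ha2 : a + a = 0) (ha0 : a ≠ 0) (hUa : ∀ u ∈ U, u * ρ a ∈ U) :
    3 * (S.card * T.card * U.card) + 16 ≠ 8 * Fintype.card A := by
  intro hV
  classical
  have h2c₀ : c₀ + c₀ = 0 := two_c0_eq_zero hρτ hτρ hττ hτ
  -- non-emptiness
  have hpos : 0 < S.card * T.card * U.card := by
    by_contra h0; push Not at h0
    have : S.card * T.card * U.card = 0 := by omega
    omega
  have hS : S.Nonempty := card_pos.1 (Nat.pos_of_ne_zero fun h0 => by rw [h0] at hpos; simp at hpos)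
  have hT : T.Nonempty := card_pos.1 (Nat.pos_of_ne_zero fun h0 => by rw [h0] at hpos; simp at hpos)
  have hU : U.Nonempty := card_pos.1 (Nat.pos_of_ne_zero fun h0 => by rw [h0] at hpos; simp at hpos)
  -- the quotient by `⟨a⟩`
  let K : AddSubgroup A := AddSubgroup.zmultiples a
  let π : A →+ A ⧸ K := QuotientAddGroup.mk' K
  have hker : ∀ x : A, π x = 0 ↔ x = 0 ∨ x = a := by
    intro x
    rw [QuotientAddGroup.mk'_apply, QuotientAddGroup.eq_zero_iff]
    exact mem_zmultiples_of_two ha2 x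
  have hπsurj : Function.Surjective π := QuotientAddGroup.mk'_surjective K
  set c₀' : A ⧸ K := π c₀ with hc₀'
  haveI : Fact (c₀' + c₀' = 0) := ⟨by rw [hc₀', ← map_add, h2c₀, map_zero]⟩
  have hcard : Fintype.card A = 2 * Fintype.card (A ⧸ K) := card_eq_two_mul_of_ker_pair π hπsurj ha0 hker
  obtain ⟨S', T', U', h', cS, cT, cU, -, -, -⟩ :=
    tpp_descend (c₀' := c₀') hρρ hρτ hτρ hττ hρ hτ hne hsurj ha2 ha0 π rfl hker h hS hT hU hUa
  have hvol : S.card * T.card * U.card = 2 * (S'.card * T'.card * U'.card) := by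
    rw [← cS, ← cT, ← cU]; ring
  have hV' : 3 * (S'.card * T'.card * U'.card) + 8 = 8 * Fintype.card (A ⧸ K) := by omega
  have hmodB : Fintype.card (A ⧸ K) % 3 = 1 := by omega
  have hB : 14 ≤ Fintype.card (A ⧸ K) := by omega
  by_cases hac : a = c₀
  · -- `a = c₀`: the quotient is `Dih(A/⟨c₀⟩)`, of order `16`, mapping onto `ℤ₄²`
    have hle : K ≤ Φ.ker := by
      refine AddSubgroup.zmultiples_le.2 ?_
      rw [AddMonoidHom.mem_ker, hac]; exact hΦc
    let φ' : A ⧸ K →+ ZMod 4 × ZMod 4 := QuotientAddGroup.lift K Φ hle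
    have hφ' : Function.Surjective φ' := by
      intro v
      obtain ⟨x, hx⟩ := hΦ v
      exact ⟨π x, by rw [← hx]; rfl⟩
    have h16 : Fintype.card (A ⧸ K) = 16 := by omega
    exact no_mod_one_law_card_16_of_onto_z4z4 (A := A ⧸ K) (G := DihedralLikeGroup (A ⧸ K) c₀')
      (ρ := DihedralLikeGroup.rho) (τ := DihedralLikeGroup.tau) (c₀ := c₀')
      DihedralLikeGroup.rho_mul_rho DihedralLikeGroup.rho_mul_tau DihedralLikeGroup.tau_mul_rho
      DihedralLikeGroup.tau_mul_tau DihedralLikeGroup.rho_injective DihedralLikeGroup.tau_injective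
      DihedralLikeGroup.rho_ne_tau DihedralLikeGroup.rho_or_tau h16 φ' hφ' h' hV'
  · -- `a ≠ c₀`: the quotient is dicyclic with `c̄₀ ≠ 0`, so its law forces `A/⟨a, c₀⟩` cyclic
    have hc₀'ne : c₀' ≠ 0 := by
      intro h0
      rcases (hker c₀).1 h0 with h1 | h1
      · exact hc₀ h1
      · exact hac h1.symm
    obtain ⟨gbar, hgbar⟩ := quot_cyclic_of_mod_one_law_of_c0_ne_zero (A := A ⧸ K)
      (G := DihedralLikeGroup (A ⧸ K) c₀')
      (ρ := DihedralLikeGroup.rho) (τ := DihedralLikeGroup.tau) (c₀ := c₀')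
      DihedralLikeGroup.rho_mul_rho DihedralLikeGroup.rho_mul_tau DihedralLikeGroup.tau_mul_rho
      DihedralLikeGroup.tau_mul_tau hc₀'ne DihedralLikeGroup.rho_injective DihedralLikeGroup.tau_injective
      DihedralLikeGroup.rho_ne_tau DihedralLikeGroup.rho_or_tau hmodB hB h' hV'
    obtain ⟨g, rfl⟩ := hπsurj gbar
    -- `A = {0, a, -c₀, a - c₀} + ⟨g⟩`
    have hlift : ∀ y : A, π y ∈ AddSubgroup.zmultiples (π g) →
        y ∈ AddSubgroup.zmultiples g ∨ y - a ∈ AddSubgroup.zmultiples g := by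
      intro y hy
      obtain ⟨k, hk⟩ := AddSubgroup.mem_zmultiples_iff.1 hy
      have h0 : π (y - k • g) = 0 := by rw [map_sub, map_zsmul, hk, sub_self]
      rcases (hker _).1 h0 with h1 | h1
      · left; exact AddSubgroup.mem_zmultiples_iff.2 ⟨k, by rw [sub_eq_zero] at h1; exact h1.symm⟩
      · right
        refine AddSubgroup.mem_zmultiples_iff.2 ⟨k, ?_⟩
        rw [← h1]; abel
    refine not_four_cosets_of_onto_z4z4 Φ hΦ (g := g) (a := a) (c := c₀) hΦc (fun x => ?_)
    rcases hgbar (π x) with hx | hx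
    · rcases hlift x hx with h1 | h1
      · exact Or.inl h1
      · exact Or.inr (Or.inl h1)
    · rw [hc₀', ← map_add] at hx
      rcases hlift (x + c₀) hx with h1 | h1
      · exact Or.inr (Or.inr (Or.inl h1))
      · exact Or.inr (Or.inr (Or.inr h1))

/-- **The reduction theorem at `|A| = 32`.**  Dicyclic type `G(A, c₀)` (`c₀ ≠ 0`), `|A| = 32`, `Φ : A ↠ ZMod 4 × ZMod 4`
with `Φ c₀ = 0`.  A TPP triple with a member stable under right multiplication by some central involution `ρ(a)`
(`2a = 0 ≠ a`) does not attain `3|S||T||U| + 16 = 8|A|`. [folklore] -/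
theorem no_dicyclic_law_of_stable_member_32
    (hρρ : ∀ a b, ρ a * ρ b = ρ (a + b)) (hρτ : ∀ a b, ρ a * τ b = τ (b - a))
    (hτρ : ∀ a b, τ a * ρ b = τ (a + b)) (hττ : ∀ a b, τ a * τ b = ρ (c₀ + b - a)) (hc₀ : c₀ ≠ 0)
    (hρ : Function.Injective ρ) (hτ : Function.Injective τ) (hne : ∀ a b, ρ a ≠ τ b)
    (hsurj : ∀ g, (∃ a, ρ a = g) ∨ (∃ a, τ a = g)) (hA : Fintype.card A = 32)
    (Φ : A →+ ZMod 4 × ZMod 4) (hΦ : Function.Surjective Φ) (hΦc : Φ c₀ = 0)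
    {S T U : Finset G} (h : TripleProductProperty S T U)
    {a : A} (ha2 : a + a = 0) (ha0 : a ≠ 0)
    (hstab : (∀ x ∈ S, x * ρ a ∈ S) ∨ (∀ x ∈ T, x * ρ a ∈ T) ∨ (∀ x ∈ U, x * ρ a ∈ U)) :
    3 * (S.card * T.card * U.card) + 16 ≠ 8 * Fintype.card A := by
  rcases hstab with hSa | hTa | hUa
  · have key := no_dicyclic_law_of_stable_third_32 hρρ hρτ hτρ hττ hc₀ hρ hτ hne hsurj hA Φ hΦ hΦc
      h.rotate ha2 ha0 hSa
    rwa [show T.card * U.card * S.card = S.card * T.card * U.card by ring] at key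
  · have key := no_dicyclic_law_of_stable_third_32 hρρ hρτ hτρ hττ hc₀ hρ hτ hne hsurj hA Φ hΦ hΦc
      h.rotate.rotate ha2 ha0 hTa
    rwa [show U.card * S.card * T.card = S.card * T.card * U.card by ring] at key
  · exact no_dicyclic_law_of_stable_third_32 hρρ hρτ hτρ hττ hc₀ hρ hτ hne hsurj hA Φ hΦ hΦc h ha2 ha0 hUa

/-- **Two-domino class at `|A| = 32`** (saturation makes `U ∪ Uρ(c₀)` a `ρ(c₀)`-stable member without losing volume).
[folklore] -/
theorem no_dicyclic_law_of_two_domino_32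
    (hρρ : ∀ a b, ρ a * ρ b = ρ (a + b)) (hρτ : ∀ a b, ρ a * τ b = τ (b - a))
    (hτρ : ∀ a b, τ a * ρ b = τ (a + b)) (hττ : ∀ a b, τ a * τ b = ρ (c₀ + b - a)) (hc₀ : c₀ ≠ 0)
    (hρ : Function.Injective ρ) (hτ : Function.Injective τ) (hne : ∀ a b, ρ a ≠ τ b)
    (hsurj : ∀ g, (∃ a, ρ a = g) ∨ (∃ a, τ a = g)) (hA : Fintype.card A = 32)
    (Φ : A →+ ZMod 4 × ZMod 4) (hΦ : Function.Surjective Φ) (hΦc : Φ c₀ = 0)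
    {S T U : Finset G} (h : TripleProductProperty S T U)
    (hs₀ : (univ.filter fun a : A => ρ a ∈ S).card = 1) (hs₁ : (univ.filter fun a : A => τ a ∈ S).card = 1)
    (ht₀ : (univ.filter fun a : A => ρ a ∈ T).card = 1) (ht₁ : (univ.filter fun a : A => τ a ∈ T).card = 1) :
    3 * (S.card * T.card * U.card) + 16 ≠ 8 * Fintype.card A := by
  intro hV
  have h2c₀ : c₀ + c₀ = 0 := two_c0_eq_zero hρτ hτρ hττ hτ
  have hmod : Fintype.card A % 3 = 2 := by omega
  set z : G := ρ c₀ with hz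
  have hzc : ∀ g, Commute z g := commute_rho_c0 hρρ hρτ hτρ hττ hτ hsurj
  have hzz : z * z = 1 := rho_c0_mul_self hρρ hρτ hτρ hττ hτ
  have hsat := tpp_saturate hzc hzz (domino_quot_stable hρρ hρτ hτρ hττ hτ hne hsurj hs₀ hs₁)
    (domino_quot_stable hρρ hρτ hτρ hττ hτ hne hsurj ht₀ ht₁) h
  have hU₂z : ∀ u ∈ U ∪ U.image (· * z), u * ρ c₀ ∈ U ∪ U.image (· * z) := by
    intro u hu
    rcases mem_union.1 hu with hu | hu
    · exact mem_union_right _ (mem_image_of_mem _ hu)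
    · obtain ⟨u', hu', rfl⟩ := mem_image.1 hu
      rw [← hz, mul_assoc, hzz, mul_one]; exact mem_union_left _ hu'
  have hne' := no_dicyclic_law_of_stable_member_32 hρρ hρτ hτρ hττ hc₀ hρ hτ hne hsurj hA Φ hΦ hΦc hsat h2c₀ hc₀
    (Or.inr (Or.inr hU₂z))
  have hle := tpp_volume_le_law_dicyclicLike hρρ hρτ hτρ hττ hρ hτ hne hsurj h2c₀ hc₀ hmod (by omega) hsat
  have hmono : U.card ≤ (U ∪ U.image (· * z)).card := card_le_card subset_union_left
  have : S.card * T.card * U.card ≤ S.card * T.card * (U ∪ U.image (· * z)).card := Nat.mul_le_mul_left _ hmono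
  omega

end Reduction

end Summit.MatrixMultiplication.OmegaCensus
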